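import Mathlib
import Literature.Computability.AlgebraicComplexity.MS21DenseOrbitsHittingSets
import Literature.Computability.AlgebraicComplexity.HittingSetsCoefficientCover
import HarnessLib

/-!
# Medini–Shpilka 2021, Def 4: the coefficients of a `Σ^{[s]}Π^{[d']}Σ` circuit are polynomials of
# degree `≤ d'` in its `s·d'·(n+1)` constants — the universal coefficient map of `ΣΠΣ`, and hitting
# sets for `Σ^{[s]}Π^{[d']}Σ` by coefficient cover

Medini–Shpilka (CCC 2021, LIPIcs 200:19 = arXiv:2102.05632), Def 4 (CCC p.19:6 = arXiv Def 1.4;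
NOT Def 12, which is the robust-hitting-set definition, p.19:8), define the depth-3 class
`Σ^{[s]}Π^{[d]}Σ` ("`Φ = Σ_{i=1}^{s} Π_{j=1}^{d} ℓ_{i,j}(x)` with affine forms `ℓ_{i,j}`") — in the tree
`MS2021.IsSPS s d f` with the constants `α : Fin s → Fin d → Option (Fin n) → F` (`none` = the constant
term, `some k` = the coefficient of `x_k`). This file is the `ΣΠΣ` companion of
`MS21AffineOrbitCoefficientMap.lean`: viewing the `s·(d'·(n+1))` constants as indeterminates `y`,

* `MS2021.SPSCoeff.genSPS n s d'` := the GENERIC `Σ^{[s]}Π^{[d']}Σ` formula over the parameter ring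
  `F[y]`; `map (eval (params α))` specialises it to the circuit with constants `α`
  (`map_eval_params_genSPS`);
* `totalDegree_coeff_genSPS_le`: each `x`-coefficient has degree `≤ d'` in `y`;
* `exists_coeff_parametrisation_isSPS`: the packaging expected by the tree's coefficient-cover engine
  `CoeffCover.exists_hittingSet` (Heintz–Schnorr type, AC/HittingSetsCoefficientCover.lean);
* `exists_hittingSet_isSPS`: for a nonempty grid `S ⊆ F` with `|S| ≥ 2d`, some `H ⊆ Sⁿ` with
  `|H| ≤ s·(d'·(n+1))·(log₂(|S|ⁿ·d' + 1) + 1) + 1` hits every nonzero `f` of degree `≤ d` computed by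
  a `Σ^{[s]}Π^{[d']}Σ` circuit.

Intended consumer: MS Cor 44 as typed (`MS2021_cor_44`, existence and size of hitting sets for
`(s-sparse)∘affine ⊆ Σ^{[s]}Π^{[d+1]}Σ`, `MS2021.isSPS_aeval_affine`). `VP ≠ VNP` is NOT proved and
nothing here bears on it; this is parametrisation bookkeeping.

## References
* [MediniShpilka2021] D. Medini, A. Shpilka, CCC 2021, LIPIcs 200:19, Def 4 (CCC p.19:6; = arXiv
  Def 1.4) and Cor 44 (p.19:14; = arXiv Cor 1.27). Erratum 2026-08-27 (val-lit ref-3 g8 DRIFT 652):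
  the first landed text cited the depth-3 class as «Def 12 (CCC p.19:7)»; locators only, no
  statement changed.
* J. Heintz, C.-P. Schnorr, *Testing polynomials which are easy to compute*, STOC 1980, Thm 4.4
  (the coefficient-cover engine, tree file `HittingSetsCoefficientCover`).
-/

noncomputable section

open MvPolynomial

namespace Literature.Computability.AlgebraicComplexity

namespace MS2021

namespace SPSCoeff

variable {K : Type*} [Field K]

/-! ### Parameter indexing -/

/-- The parameter index of the constant `α i j o` of a `Σ^{[s]}Π^{[d']}Σ` circuit on `n` variables
(`o = none`: constant term of the affine form `ℓ_{i,j}`; `o = some k`: its `x_k`-coefficient).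
[cite: MediniShpilka2021, Def 4 (CCC p.19:6)] -/
def idx (n s d' : ℕ) (i : Fin s) (j : Fin d') (o : Option (Fin n)) : Fin (s * (d' * (n + 1))) :=
  finProdFinEquiv (i, finProdFinEquiv (j, (finSuccEquiv n).symm o))

/-- The parameter point of a concrete table of constants `α`. [cite: MediniShpilka2021, Def 4 (CCC p.19:6)] -/
def params (n s d' : ℕ) (α : Fin s → Fin d' → Option (Fin n) → K) : Fin (s * (d' * (n + 1))) → K :=
  fun l => α (finProdFinEquiv.symm l).1 (finProdFinEquiv.symm (finProdFinEquiv.symm l).2).1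
    (finSuccEquiv n (finProdFinEquiv.symm (finProdFinEquiv.symm l).2).2)

omit [Field K] in
/-- `params` reads `α i j o` at `idx i j o`. [cite: MediniShpilka2021, Def 4 (CCC p.19:6)] -/
@[simp] theorem params_idx (n s d' : ℕ) (α : Fin s → Fin d' → Option (Fin n) → K) (i : Fin s)
    (j : Fin d') (o : Option (Fin n)) : params n s d' α (idx n s d' i j o) = α i j o := by
  simp only [params, idx, Equiv.symm_apply_apply, Equiv.apply_symm_apply]

/-! ### The generic `ΣΠΣ` formula over the parameter ring -/

/-- The generic affine form `ℓ_{i,j} = y_{i,j,none} + ∑_k y_{i,j,k} x_k` with INDETERMINATE constants.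
[cite: MediniShpilka2021, Def 4 (CCC p.19:6)] -/
def genForm (n s d' : ℕ) (i : Fin s) (j : Fin d') :
    MvPolynomial (Fin n) (MvPolynomial (Fin (s * (d' * (n + 1)))) K) :=
  C (X (idx n s d' i j none)) + ∑ k : Fin n, C (X (idx n s d' i j (some k))) * X k

/-- The generic `Σ^{[s]}Π^{[d']}Σ` formula `∑_i ∏_j ℓ_{i,j}` over the parameter ring `F[y]`.
[cite: MediniShpilka2021, Def 4 (CCC p.19:6)] -/
def genSPS (n s d' : ℕ) : MvPolynomial (Fin n) (MvPolynomial (Fin (s * (d' * (n + 1)))) K) :=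
  ∑ i : Fin s, ∏ j : Fin d', genForm n s d' i j

/-- Specialising the parameters at `α` gives the `ΣΠΣ` circuit with constants `α`.
[cite: MediniShpilka2021, Def 4 (CCC p.19:6)] -/
theorem map_eval_params_genSPS (n s d' : ℕ) (α : Fin s → Fin d' → Option (Fin n) → K) :
    MvPolynomial.map (MvPolynomial.eval (params n s d' α)) (genSPS (K := K) n s d') =
      ∑ i : Fin s, ∏ j : Fin d', (C (α i j none) + ∑ k : Fin n, C (α i j (some k)) * X k) := by
  simp only [genSPS, genForm, map_sum, map_prod, map_add, map_mul, map_C, map_X, eval_X, params_idx]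

/-! ### Degree of the coefficients in the parameters -/

section Degree

variable {n p : ℕ}

/-- Graded bound on parameter-degrees of coefficients: closed under sums. [folklore] -/
private theorem coeffDeg_add {D : ℕ} {P Q : MvPolynomial (Fin n) (MvPolynomial (Fin p) K)}
    (hP : ∀ μ, (coeff μ P).totalDegree ≤ D) (hQ : ∀ μ, (coeff μ Q).totalDegree ≤ D) :
    ∀ μ, (coeff μ (P + Q)).totalDegree ≤ D := fun μ => by
  rw [coeff_add]
  exact (totalDegree_add _ _).trans (max_le (hP μ) (hQ μ))

/-- Graded bound: finite sums. [folklore] -/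
private theorem coeffDeg_sum {ι : Type*} (t : Finset ι) {D : ℕ}
    {P : ι → MvPolynomial (Fin n) (MvPolynomial (Fin p) K)}
    (hP : ∀ i ∈ t, ∀ μ, (coeff μ (P i)).totalDegree ≤ D) :
    ∀ μ, (coeff μ (∑ i ∈ t, P i)).totalDegree ≤ D := fun μ => by
  rw [coeff_sum]
  exact totalDegree_finsetSum_le fun i hi => hP i hi μ

/-- Graded bound: products add degrees. [folklore] -/
private theorem coeffDeg_mul {D E : ℕ} {P Q : MvPolynomial (Fin n) (MvPolynomial (Fin p) K)}
    (hP : ∀ μ, (coeff μ P).totalDegree ≤ D) (hQ : ∀ μ, (coeff μ Q).totalDegree ≤ E) :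
    ∀ μ, (coeff μ (P * Q)).totalDegree ≤ D + E := fun μ => by
  classical
  rw [coeff_mul]
  exact totalDegree_finsetSum_le fun x _ =>
    (totalDegree_mul _ _).trans (add_le_add (hP x.1) (hQ x.2))

/-- Graded bound: products over a finset. [folklore] -/
private theorem coeffDeg_prod {ι : Type*} (t : Finset ι) {D : ι → ℕ}
    {P : ι → MvPolynomial (Fin n) (MvPolynomial (Fin p) K)}
    (hP : ∀ i ∈ t, ∀ μ, (coeff μ (P i)).totalDegree ≤ D i) :
    ∀ μ, (coeff μ (∏ i ∈ t, P i)).totalDegree ≤ ∑ i ∈ t, D i := by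
  classical
  induction t using Finset.induction_on with
  | empty =>
    intro μ
    rw [Finset.prod_empty, Finset.sum_empty, coeff_one]
    split_ifs <;> simp
  | insert a t ha ih =>
    intro μ
    rw [Finset.prod_insert ha, Finset.sum_insert ha]
    exact coeffDeg_mul (hP a (Finset.mem_insert_self a t))
      (ih fun i hi => hP i (Finset.mem_insert_of_mem hi)) μ

/-- A parameter times a variable has parameter-degree `≤ 1`. [folklore] -/
private theorem coeffDeg_C_X_mul_X (l : Fin p) (j : Fin n) :
    ∀ μ, (coeff μ (C (X l) * X j : MvPolynomial (Fin n) (MvPolynomial (Fin p) K))).totalDegree ≤ 1 :=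
  fun μ => by
  classical
  rw [coeff_C_mul, coeff_X]
  split_ifs <;> simp [totalDegree_X]

/-- A parameter as a constant has parameter-degree `≤ 1`. [folklore] -/
private theorem coeffDeg_C_X (l : Fin p) :
    ∀ μ, (coeff μ (C (X l) : MvPolynomial (Fin n) (MvPolynomial (Fin p) K))).totalDegree ≤ 1 :=
  fun μ => by
  classical
  rw [coeff_C]
  split_ifs <;> simp [totalDegree_X]

end Degree

/-- The generic affine forms have parameter-degree `≤ 1` coefficientwise. [cite: MediniShpilka2021, Def 4 (CCC p.19:6)] -/
theorem totalDegree_coeff_genForm_le (n s d' : ℕ) (i : Fin s) (j : Fin d') (μ : Fin n →₀ ℕ) :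
    (coeff μ (genForm (K := K) n s d' i j)).totalDegree ≤ 1 := by
  unfold genForm
  exact coeffDeg_add (coeffDeg_C_X _) (coeffDeg_sum (K := K) (Finset.univ : Finset (Fin n))
    (D := 1) (P := fun k => C (X (idx n s d' i j (some k))) * X k)
    (fun k _ => coeffDeg_C_X_mul_X _ _)) μ

/-- **The coefficients of the generic `Σ^{[s]}Π^{[d']}Σ` formula have degree `≤ d'` in the
parameters.** [cite: MediniShpilka2021, Def 4 (CCC p.19:6)] -/
theorem totalDegree_coeff_genSPS_le (n s d' : ℕ) (μ : Fin n →₀ ℕ) :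
    (coeff μ (genSPS (K := K) n s d')).totalDegree ≤ d' := by
  unfold genSPS
  refine coeffDeg_sum (K := K) (Finset.univ : Finset (Fin s)) (fun i _ => ?_) μ
  intro ν
  have h := coeffDeg_prod (K := K) (Finset.univ : Finset (Fin d')) (D := fun _ => 1)
    (P := fun j => genForm n s d' i j) (fun j _ => totalDegree_coeff_genForm_le n s d' i j) ν
  simpa using h

/-! ### Packaging for the coefficient-cover engine and the hitting set -/

/-- **Parametrisation of `Σ^{[s]}Π^{[d']}Σ` in the format of `CoeffCover.exists_hittingSet`.**
[cite: MediniShpilka2021, Def 4 and Cor 44 (CCC p.19:6, 19:14)] -/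
theorem exists_coeff_parametrisation_isSPS (n s d' d : ℕ) :
    ∃ Gm : {μ : Fin n →₀ ℕ | μ.degree ≤ d} → MvPolynomial (Fin (s * (d' * (n + 1)))) K,
      (∀ μ, (Gm μ).totalDegree ≤ d') ∧
      ∀ f : MvPolynomial (Fin n) K, IsSPS s d' f →
        ∃ y : Fin (s * (d' * (n + 1))) → K, ∀ μ, eval y (Gm μ) = coeff (μ : Fin n →₀ ℕ) f :=
  ⟨fun μ => coeff (μ : Fin n →₀ ℕ) (genSPS n s d'), fun μ => totalDegree_coeff_genSPS_le n s d' _,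
    fun f hf => by
      obtain ⟨α, rfl⟩ := hf
      exact ⟨params n s d' α, fun μ => by rw [← coeff_map, map_eval_params_genSPS]⟩⟩

/-- **Hitting sets for `Σ^{[s]}Π^{[d']}Σ` by coefficient cover.** For a nonempty grid `S ⊆ F` with
`|S| ≥ 2d`, some `H ⊆ Sⁿ` with `|H| ≤ s·(d'·(n+1))·(log₂(|S|ⁿ·d' + 1) + 1) + 1` hits every nonzero
`f` of degree `≤ d` computed by a `Σ^{[s]}Π^{[d']}Σ` circuit — the existence-and-size content of
hitting-set statements for `ΣΠΣ` subclasses, without any independence-map generator.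
[cite: MediniShpilka2021, Cor 44 (CCC p.19:14; existence of small hitting sets for (Σ^{[s]}Π^{[d]})^{GLaff_n} ⊆ Σ^{[s]}Π^{[d+1]}Σ)] -/
theorem exists_hittingSet_isSPS (n s d' d : ℕ) (S : Finset K) (hS1 : S.Nonempty)
    (hS : 2 * d ≤ S.card) :
    ∃ H : Finset (Fin n → K), (∀ a ∈ H, ∀ i, a i ∈ S) ∧
      H.card ≤ s * (d' * (n + 1)) * (Nat.log 2 (S.card ^ n * d' + 1) + 1) + 1 ∧
      ∀ f : MvPolynomial (Fin n) K, IsSPS s d' f → f.totalDegree ≤ d → f ≠ 0 →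
        ∃ a ∈ H, eval a f ≠ 0 := by
  obtain ⟨Gm, hGm, hcov⟩ := exists_coeff_parametrisation_isSPS (K := K) n s d' d
  obtain ⟨H, hHS, hHcard, hhit⟩ := CoeffCover.exists_hittingSet (F := K) n d (s * (d' * (n + 1)))
    d' (Finsupp.finite_of_degree_le (σ := Fin n) d) Gm hGm S hS1 hS
  exact ⟨H, hHS, hHcard, fun f hf hfd hf0 => hhit f hfd (hcov f hf) hf0⟩

end SPSCoeff

end MS2021

end Literature.Computability.AlgebraicComplexity

end
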